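import Summits.QuantumFields.YangMills.Theorems.FluctuationComparisonRegPrIntLS2BetaTreeGaugeAlgebra
import HarnessLib

/-!
# Route `FluctuationComparisonRegPrIntL` (stmt-QuantumFields-20520), LINE g18-1 S2β LAPLACE, letter (C3) — THE TREE-GAUGE SPLITTING OF PRODUCT HAAR MEASURE
# (generic: a rooted gauge fixing on a finite graph splits `G^{bonds} ≅ 𝒢_{roots} × G^{bonds ∖ comb}` by a measure-preserving bijection)

Cell `ym3-torus` (HUMAN RULING D-0037 — YM₃ on T³ is ladder rung R3, not the Clay problem), width seat `ym3-torus-px21` g9; count-neutral helper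
(`--kind proof --supports stmt-QuantumFields-20520 --as helper`).  Theorems only: 0 `def`, 0 `instance`, 0 `notation`, 0 `sorry`.

THE SETTING (all data displayed).  A finite graph: sites `ι`, bonds `β`, end points `s t : β → ι`; a compact second-countable group `G` with a Haar
probability measure `μG`; the GAUGE ACTION of `a : ι → G` on `V : β → G`, `(a • V) b = a (s b) · V b · (a (t b))⁻¹` (spelled out); a set of ROOTS
`R ⊆ ι` and a set of COMB BONDS `F ⊆ β`; and a TRANSPORTER `g : (β → G) → (ι → G)` (in the application: the holonomy along the coordinate comb from the
centre of the block of `x` to `x`, [Balaban1985Variational] (19) p.281 «exactly one gauge transformation u satisfying R̄₀uʲ = 1», lit `T4RootedResidualGauge`)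
subject to the five TREE-GAUGE AXIOMS: measurable (`hgm`), trivial at the roots (`hgR`), covariant under root-trivial transformations
`g (a • V) x = g V x · (a x)⁻¹` (`hcov`), COMB-KILLING `(g V • V) b = 1` for `b ∈ F` (`hkill`), and LOCAL `g V` depends on `V|_F` only (`hloc`) with `g 1 = 1` (`hg1`).

WHAT IS PROVED.  With `Ξ(w, u) := ŵ • û` (`ŵ` = `w` extended by `1` on the roots, `û` = `u` extended by `1` on the comb) and
`Ψ(V) := ((g V ·)⁻¹ off the roots, (g V • V) off the comb)`:
* §1 ★ `xi_psi` ∕ ★ `psi_xi`: `Ξ ∘ Ψ = id`, `Ψ ∘ Ξ = id` — every configuration is UNIQUELY a root-trivial gauge transform of a comb-trivial one;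
* §2 ★★ `measurePreserving_psi` ∕ ★★ `measurePreserving_xi`: `Ψ` and `Ξ` carry the product Haar measure `⊗_β μG` to∕from `(⊗_{ι∖R} μG) ⊗ (⊗_{β∖F} μG)` — by
  UNIQUENESS of the Haar probability on the compact group `G^{ι∖R} × G^{β∖F}`: `Ψ_*(⊗μG)` is a left-invariant probability measure, because left translation by
  `(a, h)` downstairs is realised upstairs by the `⊗μG`-preserving map `V ↦ â • L_h V`, `(L_h V) b = (g V (s b))⁻¹ h_b (g V (s b)) V b` off the comb (a skew
  product over the comb coordinates, Mathlib `MeasurePreserving.skew_product`);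
* §3 ★ `restrict_image_xi_eq_map`: the CHART IDENTITY `(⊗_β μG)|_{Ξ(A)} = Ξ_*((⊗ ⊗)|_A)` for measurable `A` (density `1`) — the form consumed by
  `Literature.Analysis.Asymptotics.LaplaceMethodChartComposition.chart_comp_of_injOn` on the way to the tubular chart (C3).

HONEST SCOPE.  Finite-dimensional measure theory on compact groups ([folklore]: complete axial ∕ tree gauge fixing, Faddeev–Popov with unit Jacobian);
nothing of Bałaban's analysis; (C3) ∕ CHART∞ ∕ LIMIT ∕ LAPLACE ∕ S2β ∕ stmt-QuantumFields-20520 are NOT proved here; rung R3 = YM₃ on T³ — NOT d = 4, NOT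
infinite volume, NOT a mass gap, NOT Clay.
-/

noncomputable section

open MeasureTheory MeasureTheory.Measure Set Function Filter
open scoped ENNReal

namespace Summit.QuantumFields.YangMills.Theorems.FluctuationComparisonRegPrIntLS2BetaTreeGaugeHaar

open Summit.QuantumFields.YangMills.Theorems.FluctuationComparisonRegPrIntLS2BetaTreeGaugeAlgebra

variable {ι β G : Type*} [Group G]

section Measure

variable [Fintype ι] [Fintype β]
variable [TopologicalSpace G] [IsTopologicalGroup G] [CompactSpace G] [MeasurableSpace G] [BorelSpace G]
  [SecondCountableTopology G]
variable (μG : Measure G) [μG.IsHaarMeasure] [IsProbabilityMeasure μG]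
variable (s t : β → ι) (R : Set ι) [DecidablePred (· ∈ R)] (F : Set β) [DecidablePred (· ∈ F)]
  (g : (β → G) → (ι → G))

omit [Fintype ι] [SecondCountableTopology G] [IsProbabilityMeasure μG] in
/-- The gauge action of a fixed transformation preserves the product Haar measure (bondwise two-sided translations; a Haar measure on a compact group is
right invariant). [cite: Balaban1985Averaging, (10) p.18] -/
theorem measurePreserving_act (a : ι → G) :
    MeasurePreserving (fun V : β → G => fun b => a (s b) * V b * (a (t b))⁻¹)
      (Measure.pi fun _ : β => μG) (Measure.pi fun _ : β => μG) := by
  haveI : μG.IsMulRightInvariant := Literature.MeasureTheory.Group.HaarLocalChart.isMulRightInvariant_of_isHaarMeasure μG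
  exact measurePreserving_pi (fun _ : β => μG) (fun _ : β => μG)
    (f := fun b (x : G) => a (s b) * x * (a (t b))⁻¹)
    (fun b => (measurePreserving_mul_right μG (a (t b))⁻¹).comp (measurePreserving_mul_left μG (a (s b))))

omit [Fintype ι] [IsProbabilityMeasure μG] in
/-- **THE OFF-COMB SHEAR PRESERVES PRODUCT HAAR**: for a fixed `h : β ∖ F → G`, the map `V ↦ L_h V`, `(L_h V) b = V b` on the comb and
`(g V (s b))⁻¹ · h_b · g V (s b) · V b` off the comb, preserves `⊗_β μG` — a skew product over the comb coordinates (the multiplier depends on `V|_F` only, by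
locality of `g`), Mathlib `MeasurePreserving.skew_product` through `MeasurableEquiv.piEquivPiSubtypeProd`. [folklore] -/
theorem measurePreserving_shear (hgm : Measurable g) (hloc : ∀ V V' : β → G, (∀ b ∈ F, V b = V' b) → g V = g V')
    (h : {b // b ∉ F} → G) :
    MeasurePreserving (fun V : β → G => fun b : β =>
        if hb : b ∈ F then V b else (g V (s b))⁻¹ * h ⟨b, hb⟩ * g V (s b) * V b)
      (Measure.pi fun _ : β => μG) (Measure.pi fun _ : β => μG) := by
  classical
  -- split the coordinates along the comb
  set e := MeasurableEquiv.piEquivPiSubtypeProd (fun _ : β => G) (· ∈ F) with he_def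
  have he : MeasurePreserving e (Measure.pi fun _ : β => μG)
      ((Measure.pi fun _ : {b // b ∈ F} => μG).prod (Measure.pi fun _ : {b // b ∉ F} => μG)) :=
    measurePreserving_piEquivPiSubtypeProd (fun _ : β => μG) (· ∈ F)
  -- the multiplier as a function of the comb coordinates only
  set γ : ({b // b ∈ F} → G) → (ι → G) := fun VF => g (e.symm (VF, fun _ => 1)) with hγ_def
  have hγm : Measurable γ :=
    hgm.comp (e.symm.measurable.comp (measurable_id.prodMk measurable_const))
  set m : ({b // b ∈ F} → G) → ({b // b ∉ F} → G) := fun VF b => (γ VF (s b))⁻¹ * h b * γ VF (s b) with hm_def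
  have hmm : Measurable m := by
    refine measurable_pi_iff.2 fun b => ?_
    have h1 : Measurable fun VF => γ VF (s b) := (measurable_pi_apply _).comp hγm
    exact (h1.inv.mul measurable_const).mul h1
  -- the skew product downstairs
  have hskew : MeasurePreserving (fun q : ({b // b ∈ F} → G) × ({b // b ∉ F} → G) => (q.1, m q.1 * q.2))
      ((Measure.pi fun _ : {b // b ∈ F} => μG).prod (Measure.pi fun _ : {b // b ∉ F} => μG))
      ((Measure.pi fun _ : {b // b ∈ F} => μG).prod (Measure.pi fun _ : {b // b ∉ F} => μG)) := by
    refine (MeasurePreserving.id _).skew_product (g := fun a y => m a * y) ?_ ?_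
    · exact (hmm.comp measurable_fst).mul measurable_snd
    · exact Filter.Eventually.of_forall fun a => map_mul_left_eq_self _ _
  -- conjugate back
  have hcomp := (he.symm e).comp (hskew.comp he)
  have hfeq : (fun V : β → G => fun b : β =>
        if hb : b ∈ F then V b else (g V (s b))⁻¹ * h ⟨b, hb⟩ * g V (s b) * V b) =
      e.symm ∘ (fun q : ({b // b ∈ F} → G) × ({b // b ∉ F} → G) => (q.1, m q.1 * q.2)) ∘ e := by
    funext V
    show _ = e.symm ((e V).1, m (e V).1 * (e V).2)
    funext b
    symm
    have hγV : γ (e V).1 = g V := by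
      apply hloc
      intro b' hb'
      show (e.symm ((e V).1, fun _ => 1)) b' = V b'
      simp [he_def, MeasurableEquiv.piEquivPiSubtypeProd, Equiv.piEquivPiSubtypeProd, hb']
    show (e.symm ((e V).1, m (e V).1 * (e V).2)) b = _
    by_cases hb : b ∈ F
    · simp [he_def, MeasurableEquiv.piEquivPiSubtypeProd, Equiv.piEquivPiSubtypeProd, hb]
    · simp only [dif_neg hb]
      have h2 : (e.symm ((e V).1, m (e V).1 * (e V).2)) b = (m (e V).1 * (e V).2) ⟨b, hb⟩ := by
        simp [he_def, MeasurableEquiv.piEquivPiSubtypeProd, Equiv.piEquivPiSubtypeProd, hb]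
      rw [h2, Pi.mul_apply, hm_def]
      simp only [hγV]
      show (g V (s b))⁻¹ * h ⟨b, hb⟩ * g V (s b) * (e V).2 ⟨b, hb⟩ = _
      congr 1
  rw [hfeq]
  exact hcomp

/-- ★★ **THE TREE-GAUGE SPLITTING OF PRODUCT HAAR MEASURE**: `Ψ = ((g ·)⁻¹|_{ι∖R}, (g · • ·)|_{β∖F})` carries `⊗_β μG` to `(⊗_{ι∖R} μG) ⊗ (⊗_{β∖F} μG)`.
PROOF: `Ψ_*(⊗μG)` is a probability measure on the compact group `G^{ι∖R} × G^{β∖F}` that is LEFT-INVARIANT — left translation by `(a, h)` downstairs is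
`Ψ ∘ T` with `T = (â • ·) ∘ L_h` measure-preserving upstairs (`measurePreserving_act`, `measurePreserving_shear`; covariance `hcov`, locality `hloc`) —
hence a Haar measure, hence THE product Haar probability (uniqueness, Mathlib `isHaarMeasure_eq_of_isProbabilityMeasure`).
[cite: Balaban1985Averaging, (10) p.18; Helgason2000, Ch. I §1 Thm 1.14 p. 96 (uniqueness of Haar measure)] -/
theorem measurePreserving_psi (hgm : Measurable g)
    (hcov : ∀ (a : ι → G), (∀ r ∈ R, a r = 1) → ∀ (V : β → G) (x : ι),
      g (fun b => a (s b) * V b * (a (t b))⁻¹) x = g V x * (a x)⁻¹)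
    (hloc : ∀ V V' : β → G, (∀ b ∈ F, V b = V' b) → g V = g V') :
    MeasurePreserving (fun V : β → G =>
        ((fun x : {x // x ∉ R} => (g V x)⁻¹), (fun b : {b // b ∉ F} => g V (s b) * V b * (g V (t b))⁻¹)))
      (Measure.pi fun _ : β => μG)
      ((Measure.pi fun _ : {x // x ∉ R} => μG).prod (Measure.pi fun _ : {b // b ∉ F} => μG)) := by
  classical
  set Ψ : (β → G) → ({x // x ∉ R} → G) × ({b // b ∉ F} → G) := fun V =>
    ((fun x : {x // x ∉ R} => (g V x)⁻¹), (fun b : {b // b ∉ F} => g V (s b) * V b * (g V (t b))⁻¹)) with hΨ_def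
  have hΨm : Measurable Ψ := measurable_psi s t R F g hgm
  set lam := Measure.map Ψ (Measure.pi fun _ : β => μG) with hlam_def
  -- LEFT INVARIANCE of `Ψ_*(⊗ μG)`
  have hinv : ∀ q : ({x // x ∉ R} → G) × ({b // b ∉ F} → G), Measure.map (fun p => q * p) lam = lam := by
    intro q
    -- the root-trivial extension of `q.1` and the upstairs map `T = (â • ·) ∘ L_{q.2}`
    set ah : ι → G := fun x => if hx : x ∈ R then (1 : G) else q.1 ⟨x, hx⟩ with hah_def
    have hahR : ∀ r ∈ R, ah r = 1 := fun r hr => by simp [hah_def, hr]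
    set L : (β → G) → (β → G) := fun V b =>
      if hb : b ∈ F then V b else (g V (s b))⁻¹ * q.2 ⟨b, hb⟩ * g V (s b) * V b with hL_def
    set A : (β → G) → (β → G) := fun V b => ah (s b) * V b * (ah (t b))⁻¹ with hA_def
    have hT : MeasurePreserving (A ∘ L) (Measure.pi fun _ : β => μG) (Measure.pi fun _ : β => μG) :=
      (measurePreserving_act μG s t ah).comp (measurePreserving_shear μG s F g hgm hloc q.2)
    -- `g` along `T`: `g (A (L V)) x = g V x · (â x)⁻¹`
    have hgL : ∀ V, g (L V) = g V := fun V => (hloc V (L V) fun b hb => by simp [hL_def, hb]).symm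
    have hgT : ∀ V x, g (A (L V)) x = g V x * (ah x)⁻¹ := fun V x => by
      rw [show A (L V) = fun b => ah (s b) * L V b * (ah (t b))⁻¹ from rfl, hcov ah hahR (L V) x, hgL]
    -- the commutation `(q * ·) ∘ Ψ = Ψ ∘ T`
    have hcomm : (fun p => q * p) ∘ Ψ = Ψ ∘ (A ∘ L) := by
      funext V
      refine Prod.ext ?_ ?_
      · funext x
        show q.1 x * (g V x)⁻¹ = (g (A (L V)) x)⁻¹
        rw [hgT, mul_inv_rev, inv_inv]
        congr 1
        simp [hah_def, x.2]
      · funext b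
        show q.2 b * (g V (s b) * V b * (g V (t b))⁻¹) = g (A (L V)) (s b) * (A (L V)) b * (g (A (L V)) (t b))⁻¹
        rw [hgT, hgT]
        have hLb : L V b = (g V (s b))⁻¹ * q.2 b * g V (s b) * V b := by simp [hL_def, b.2]
        show _ = g V (s b) * (ah (s b))⁻¹ * (ah (s b) * L V b * (ah (t b))⁻¹) * (g V (t b) * (ah (t b))⁻¹)⁻¹
        rw [hLb]
        group
    calc Measure.map (fun p => q * p) lam
        = Measure.map ((fun p => q * p) ∘ Ψ) (Measure.pi fun _ : β => μG) := Measure.map_map (measurable_const_mul q) hΨm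
      _ = Measure.map (Ψ ∘ (A ∘ L)) (Measure.pi fun _ : β => μG) := by rw [hcomm]
      _ = Measure.map Ψ (Measure.map (A ∘ L) (Measure.pi fun _ : β => μG)) := (Measure.map_map hΨm hT.measurable).symm
      _ = lam := by rw [hT.map_eq]
  haveI : lam.IsMulLeftInvariant := ⟨hinv⟩
  haveI : IsProbabilityMeasure lam := isProbabilityMeasure_map hΨm.aemeasurable
  haveI : lam.IsHaarMeasure :=
    isHaarMeasure_of_isCompact_nonempty_interior lam univ isCompact_univ (by simp) (by simp) (measure_ne_top _ _)
  have heq : lam = (Measure.pi fun _ : {x // x ∉ R} => μG).prod (Measure.pi fun _ : {b // b ∉ F} => μG) :=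
    isHaarMeasure_eq_of_isProbabilityMeasure _ _
  exact ⟨hΨm, heq⟩

/-- ★★ **… AND BACK**: `Ξ(w, u) = ŵ • û` carries `(⊗_{ι∖R} μG) ⊗ (⊗_{β∖F} μG)` to the product Haar measure `⊗_β μG` (`Ξ = Ψ⁻¹`, §1).
[cite: Balaban1985Averaging, (10) p.18; Helgason2000, Ch. I §1 Thm 1.14 p. 96] -/
theorem measurePreserving_xi (hgm : Measurable g) (hgR : ∀ V, ∀ r ∈ R, g V r = 1)
    (hcov : ∀ (a : ι → G), (∀ r ∈ R, a r = 1) → ∀ (V : β → G) (x : ι),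
      g (fun b => a (s b) * V b * (a (t b))⁻¹) x = g V x * (a x)⁻¹)
    (hkill : ∀ V, ∀ b ∈ F, g V (s b) * V b * (g V (t b))⁻¹ = 1)
    (hloc : ∀ V V' : β → G, (∀ b ∈ F, V b = V' b) → g V = g V') :
    MeasurePreserving (fun p : ({x // x ∉ R} → G) × ({b // b ∉ F} → G) => fun b : β =>
        (fun x : ι => if hx : x ∈ R then (1 : G) else p.1 ⟨x, hx⟩) (s b) *
          (fun b : β => if hb : b ∈ F then (1 : G) else p.2 ⟨b, hb⟩) b *
          ((fun x : ι => if hx : x ∈ R then (1 : G) else p.1 ⟨x, hx⟩) (t b))⁻¹)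
      ((Measure.pi fun _ : {x // x ∉ R} => μG).prod (Measure.pi fun _ : {b // b ∉ F} => μG))
      (Measure.pi fun _ : β => μG) := by
  classical
  have hΨ := measurePreserving_psi μG s t R F g hgm hcov hloc
  have hΞm := measurable_xi (G := G) s t R F
  refine ⟨hΞm, ?_⟩
  -- `Ξ_* (Ψ_* ⊗μG) = (Ξ ∘ Ψ)_* ⊗μG = ⊗μG`
  rw [← hΨ.map_eq, Measure.map_map hΞm hΨ.measurable]
  have hid : ((fun p : ({x // x ∉ R} → G) × ({b // b ∉ F} → G) => fun b : β =>
        (fun x : ι => if hx : x ∈ R then (1 : G) else p.1 ⟨x, hx⟩) (s b) *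
          (fun b : β => if hb : b ∈ F then (1 : G) else p.2 ⟨b, hb⟩) b *
          ((fun x : ι => if hx : x ∈ R then (1 : G) else p.1 ⟨x, hx⟩) (t b))⁻¹) ∘
      (fun V : β → G =>
        ((fun x : {x // x ∉ R} => (g V x)⁻¹), (fun b : {b // b ∉ F} => g V (s b) * V b * (g V (t b))⁻¹)))) = id := by
    funext V
    exact xi_psi s t R F g hgR hkill V
  rw [hid, Measure.map_id]

/-! ## §3  The chart identity of the tree gauge (density `1`) -/

/-- ★ **THE CHART IDENTITY OF THE TREE GAUGE**: for every measurable `A ⊆ G^{ι∖R} × G^{β∖F}`,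
`(⊗_β μG)|_{Ξ(A)} = Ξ_*(((⊗_{ι∖R} μG) ⊗ (⊗_{β∖F} μG))|_A)` — the `hchart` format of `Literature.Analysis.Asymptotics.LaplaceMethodChartComposition.chart_comp_of_injOn`
with density `1` (from `measurePreserving_xi` and the injectivity `psi_xi`). [cite: Breitung1994, §2.3 Definitions 4–5 pp. 14–15; Balaban1985Averaging, (10) p.18] -/
theorem restrict_image_xi_eq_map (hgm : Measurable g) (hgR : ∀ V, ∀ r ∈ R, g V r = 1)
    (hcov : ∀ (a : ι → G), (∀ r ∈ R, a r = 1) → ∀ (V : β → G) (x : ι),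
      g (fun b => a (s b) * V b * (a (t b))⁻¹) x = g V x * (a x)⁻¹)
    (hkill : ∀ V, ∀ b ∈ F, g V (s b) * V b * (g V (t b))⁻¹ = 1)
    (hloc : ∀ V V' : β → G, (∀ b ∈ F, V b = V' b) → g V = g V') (hg1 : g (fun _ => 1) = fun _ => 1)
    {A : Set (({x // x ∉ R} → G) × ({b // b ∉ F} → G))} (hA : MeasurableSet A) :
    (Measure.pi fun _ : β => μG).restrict
        ((fun p : ({x // x ∉ R} → G) × ({b // b ∉ F} → G) => fun b : β =>
          (fun x : ι => if hx : x ∈ R then (1 : G) else p.1 ⟨x, hx⟩) (s b) *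
            (fun b : β => if hb : b ∈ F then (1 : G) else p.2 ⟨b, hb⟩) b *
            ((fun x : ι => if hx : x ∈ R then (1 : G) else p.1 ⟨x, hx⟩) (t b))⁻¹) '' A) =
      Measure.map (fun p : ({x // x ∉ R} → G) × ({b // b ∉ F} → G) => fun b : β =>
          (fun x : ι => if hx : x ∈ R then (1 : G) else p.1 ⟨x, hx⟩) (s b) *
            (fun b : β => if hb : b ∈ F then (1 : G) else p.2 ⟨b, hb⟩) b *
            ((fun x : ι => if hx : x ∈ R then (1 : G) else p.1 ⟨x, hx⟩) (t b))⁻¹)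
        (((Measure.pi fun _ : {x // x ∉ R} => μG).prod (Measure.pi fun _ : {b // b ∉ F} => μG)).restrict A) := by
  classical
  set Ξ := (fun p : ({x // x ∉ R} → G) × ({b // b ∉ F} → G) => fun b : β =>
          (fun x : ι => if hx : x ∈ R then (1 : G) else p.1 ⟨x, hx⟩) (s b) *
            (fun b : β => if hb : b ∈ F then (1 : G) else p.2 ⟨b, hb⟩) b *
            ((fun x : ι => if hx : x ∈ R then (1 : G) else p.1 ⟨x, hx⟩) (t b))⁻¹) with hΞ_def
  set Ψ : (β → G) → ({x // x ∉ R} → G) × ({b // b ∉ F} → G) := fun V =>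
    ((fun x : {x // x ∉ R} => (g V x)⁻¹), (fun b : {b // b ∉ F} => g V (s b) * V b * (g V (t b))⁻¹)) with hΨ_def
  have hΞ := measurePreserving_xi μG s t R F g hgm hgR hcov hkill hloc
  have hΨm : Measurable Ψ := measurable_psi s t R F g hgm
  -- `Ξ` is injective with inverse `Ψ`; its image of `A` is the measurable set `Ψ⁻¹ A`
  have hinj : Injective Ξ := by
    intro p p' h
    have h1 := psi_xi s t R F g hcov hloc hg1 p.1 p.2
    have h2 := psi_xi s t R F g hcov hloc hg1 p'.1 p'.2
    have : Ψ (Ξ p) = Ψ (Ξ p') := by rw [h]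
    rw [show Ψ (Ξ p) = (p.1, p.2) from h1, show Ψ (Ξ p') = (p'.1, p'.2) from h2] at this
    exact Prod.ext (congrArg Prod.fst this) (congrArg Prod.snd this)
  have himg : Ξ '' A = Ψ ⁻¹' A := by
    ext V
    constructor
    · rintro ⟨p, hp, rfl⟩
      show Ψ (Ξ p) ∈ A
      rw [show Ψ (Ξ p) = (p.1, p.2) from psi_xi s t R F g hcov hloc hg1 p.1 p.2]
      exact hp
    · intro hV
      exact ⟨Ψ V, hV, xi_psi s t R F g hgR hkill V⟩
  ext S hS
  rw [Measure.map_apply hΞ.measurable hS, Measure.restrict_apply hS, Measure.restrict_apply (hΞ.measurable hS),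
    ← hΞ.measure_preimage (hS.inter (himg ▸ hΨm hA)).nullMeasurableSet]
  congr 1
  ext p
  simp only [mem_preimage, mem_inter_iff, himg]
  constructor
  · rintro ⟨h1, h2⟩
    refine ⟨h1, ?_⟩
    have : Ψ (Ξ p) = (p.1, p.2) := psi_xi s t R F g hcov hloc hg1 p.1 p.2
    rw [this] at h2
    simpa using h2
  · rintro ⟨h1, h2⟩
    refine ⟨h1, ?_⟩
    show Ψ (Ξ p) ∈ A
    rw [show Ψ (Ξ p) = (p.1, p.2) from psi_xi s t R F g hcov hloc hg1 p.1 p.2]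
    simpa using h2

end Measure

end Summit.QuantumFields.YangMills.Theorems.FluctuationComparisonRegPrIntLS2BetaTreeGaugeHaar

end
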